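import Summits.CriticalPhenomena.PercolationContinuityZ3.Theorems.SahiMasterFamilyRadialDerivative
import Summits.CriticalPhenomena.PercolationContinuityZ3.Theorems.SahiMasterFamilyUCBernsteinPartialUnions

/-!
# The radial derivative through restrictions: `∂_BΦ = −(|B|−1)!·Φ(β|_{Bᶜ})` at EVERY proper block, the criterion
# "all restrictions nonnegative ⇒ radially non-decreasing", and (R2-hull) as a THEOREM on the partial-unions class

Unit `prim-masterthm-p4` (gen 29; crux anchor stmt-CriticalPhenomena-4575, helper work; memo
`run/shared/lean/prim/prim-masterthm/prim-masterthm-p4/P4-GEN29-REPORT.md`).  Companion of `…RadialDerivative` (`radialDeriv`, `slope`, `R2Hull`,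
`ucHullNonneg_of_R2Hull`, `r2Slack_eq_radialDeriv`) and `…UCBernsteinPartialUnions` (Φ ≥ 0 on the simplex for collections with union-closed partial unions).

RESULTS (all orders, axioms standard):
* `exists_emb_slope`: for every nonempty proper block `B`, `slope β B = −(|B|−1)!·Φ_{m+1}(β ∘ e)` along an embedding `e` of `Bᶜ` (the block-expansion
  factor of `…BernsteinPos`, moved to an arbitrary block by the relabelling equivariance `slope_actV`).
* **`radialDeriv_nonneg_of_restrictions`**: if `β ≤ 1`, `β univ = 1` and `Φ(β|_R) ≥ 0` for every proper pulled-back set function, then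
  `0 ≤ radialDeriv β` (every term `(β_B − 1)·slope_B = (1 − β_B)(|B|−1)!Φ(β|_{Bᶜ})` is `≥ 0`).
* **`radialDeriv_mixS_nonneg_of_partialUnions`**: (R2-hull) HOLDS, pointwise on the simplex, for every finite collection of families containing `univ`
  whose partial unions are union-closed (chains of any length, collections of up-sets, nested pairs, …) — the multi-family analogue of
  `GoodDebt.bpos_r2Slack_of_disjointUnion`.
* `radialDeriv_mix_nonneg_of_disjointUnion`: pointwise (R2) on an edge for union-closed pairs with the disjoint-union condition (from the coefficientwise
  kernel theorem and the edge identification).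
* `r2Slack_nonneg_of_R2Hull`: `R2Hull n` gives the typed pair criterion (R2) pointwise on every edge.
HONEST FRAMING: the class where (R2-hull) is now a theorem is the class where conjecture (B)/(UC-hull) was already a theorem (gen 22); (R2-hull), (R2), (B),
`UCHullNonneg k` (k ≥ 8), Sahi's `C_k` and the master theorem remain OPEN. [this work]
-/

noncomputable section

open scoped Classical

namespace Summit.CriticalPhenomena.PercolationContinuityZ3.Theorems

namespace RadialDeriv

open Finset Function Equiv
open Literature.Combinatorics.Sahi2008
open Literature.Combinatorics.Sahi2008.CycleForm
open PrincipalCapBeta (phiSet realF realW)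
open BernsteinPos RootSummed BernsteinSimplex UCBernsteinPartialUnions

variable {k : ℕ}

/-- A transposition relabelling is an involution on set functions. [this work] -/
theorem actV_swap_actV_swap (a b : Fin (k + 1)) (β : Finset (Fin (k + 1)) → ℝ) :
    PhiCert.actV (Equiv.swap a b) (PhiCert.actV (Equiv.swap a b) β) = β := by
  funext S
  unfold PhiCert.actV
  rw [Finset.map_map]
  have e : (Equiv.swap a b).toEmbedding.trans (Equiv.swap a b).toEmbedding = (Equiv.refl _).toEmbedding := by
    ext x; simp [Equiv.swap_apply_self]
  rw [e]
  simp

/-- **`∂_BΦ = −(|B|−1)!·Φ(β|_{Bᶜ})` at every nonempty proper block**, along an embedding of the complement. [this work] -/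
theorem exists_emb_slope (β : Finset (Fin (k + 1)) → ℝ) {B : Finset (Fin (k + 1))} (hne : B.Nonempty) (hBu : B ≠ univ) :
    ∃ (m : ℕ) (e : Fin (m + 1) ↪ Fin (k + 1)), (∀ j, e j ∉ B) ∧
      slope (k + 1) β B = -(((B.card - 1).factorial : ℝ) * phiSet (m + 1) (fun S => β (S.map e))) := by
  obtain ⟨z, hz⟩ := hne
  set σ := Equiv.swap z (Fin.last k) with hσ
  set β' := PhiCert.actV σ β with hβ'
  have hββ : β = PhiCert.actV σ β' := by rw [hβ', hσ, actV_swap_actV_swap]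
  have hl : Fin.last k ∈ B.map σ.toEmbedding := by
    rw [Finset.mem_map_equiv, hσ, Equiv.symm_swap, Equiv.swap_apply_right]; exact hz
  have hBu' : B.map σ.toEmbedding ≠ univ := fun h =>
    hBu (Finset.map_injective σ.toEmbedding (by rw [h, Finset.map_univ_equiv]))
  obtain ⟨m, e, he, hc⟩ := exists_emb_coRest hBu'
  refine ⟨m, e.trans σ.toEmbedding, fun j => ?_, ?_⟩
  · have h1 := he j
    rw [Finset.mem_map_equiv, hσ, Equiv.symm_swap] at h1
    exact h1
  · have hfun : (fun S : Finset (Fin (m + 1)) => β' (S.map e)) = fun S => β (S.map (e.trans σ.toEmbedding)) := by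
      funext S; rw [hβ']; show β ((S.map e).map σ.toEmbedding) = _; rw [Finset.map_map]
    rw [hββ, slope_actV, slope_eq_of_last_mem β' hl, Finset.card_map, hc β', ← hββ, hfun, mul_neg]

/-- **Criterion**: `β ≤ 1`, `β univ = 1` and all proper restrictions `Φ(β|_R) ≥ 0` give `0 ≤ radialDeriv β` — radial monotonicity from the top
vertex at `β`. [this work] -/
theorem radialDeriv_nonneg_of_restrictions (β : Finset (Fin (k + 1)) → ℝ) (h1 : ∀ S, β S ≤ 1) (hu : β univ = 1)
    (hres : ∀ (m : ℕ) (e : Fin (m + 1) ↪ Fin (k + 1)), 0 ≤ phiSet (m + 1) (fun S => β (S.map e))) :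
    0 ≤ radialDeriv (k + 1) β := by
  rw [radialDeriv_eq_sum_slope]
  refine sum_nonneg fun B _ => ?_
  by_cases hBu : B = univ
  · rw [hBu, hu, sub_self, zero_mul]
  by_cases hBe : B = ∅
  · rw [hBe, slope_empty, mul_zero]
  obtain ⟨m, e, _, hs⟩ := exists_emb_slope β (Finset.nonempty_iff_ne_empty.2 hBe) hBu
  rw [hs, mul_neg, ← neg_mul, neg_sub]
  exact mul_nonneg (sub_nonneg.2 (h1 B)) (mul_nonneg (Nat.cast_nonneg _) (hres m e))

variable {α : Type} [Fintype α]

/-- **(R2-hull) on the partial-unions class (THEOREM, every order, pointwise on the simplex)**: for every finite collection of families of subsets of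
`Fin (k+1)` containing `univ` whose partial unions `⋃_{x∈Y} 𝒰_x` are all union-closed, the radial derivative of Sahi's functional from the top vertex is
`≥ 0` at the mixture `Σ_x w_x 1_{𝒰_x}`. [this work] -/
theorem radialDeriv_mixS_nonneg_of_partialUnions (𝒰 : α → Finset (Finset (Fin (k + 1))))
    (hPU : ∀ Y : Finset α, ∀ A ∈ Y.biUnion 𝒰, ∀ B ∈ Y.biUnion 𝒰, A ∪ B ∈ Y.biUnion 𝒰) (htop : ∀ x, univ ∈ 𝒰 x)
    {w : α → ℝ} (hw0 : ∀ x, 0 ≤ w x) (hw1 : ∑ x, w x = 1) : 0 ≤ radialDeriv (k + 1) (mixS 𝒰 w) := by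
  refine radialDeriv_nonneg_of_restrictions _ (fun S => GoodDebt.mixture_le_one w 𝒰 hw0 hw1 S) ?_ fun m e => ?_
  · show ∑ x, w x * (if univ ∈ 𝒰 x then (1 : ℝ) else 0) = 1
    exact (sum_congr rfl fun x _ => by rw [if_pos (htop x), mul_one]).trans hw1
  · rw [mixS_map e 𝒰 w]
    exact phiSet_mixS_nonneg_of_partialUnions _ (partialUnions_comap e 𝒰 hPU) hw0 hw1

/-- Pointwise (R2) on an edge for union-closed pairs with the disjoint-union condition (nested pairs, pairs of up-sets, union-closed unions, segments),
from the coefficientwise kernel theorem `GoodDebt.bpos_r2Slack_of_disjointUnion` and the edge identification. [this work] -/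
theorem radialDeriv_mix_nonneg_of_disjointUnion {n : ℕ} (𝒰 𝒱 : Finset (Finset (Fin (n + 1))))
    (hUC : ∀ A ∈ 𝒰, ∀ B ∈ 𝒰, A ∪ B ∈ 𝒰) (hVC : ∀ A ∈ 𝒱, ∀ B ∈ 𝒱, A ∪ B ∈ 𝒱)
    (hD : ∀ A ∈ 𝒰, ∀ B ∈ 𝒱, Disjoint A B → A ∪ B ∈ 𝒰 ∪ 𝒱) (hU : univ ∈ 𝒰) (hV : univ ∈ 𝒱)
    {w : ℝ} (hw0 : 0 ≤ w) (hw1 : w ≤ 1) : 0 ≤ radialDeriv (n + 1) (mix 𝒰 𝒱 w) := by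
  rw [← r2Slack_eq_radialDeriv 𝒰 𝒱 hU hV]
  exact (GoodDebt.bpos_r2Slack_of_disjointUnion 𝒰 𝒱 hUC hVC hD).nonneg hw0 hw1

/-- An edge point is the two-label mixture. [this work] -/
theorem mix_eq_mixS_bool {n : ℕ} (𝒰 𝒱 : Finset (Finset (Fin n))) (w : ℝ) :
    mix 𝒰 𝒱 w = fun S => ∑ b : Bool, (cond b w (1 - w)) * (if S ∈ cond b 𝒰 𝒱 then (1 : ℝ) else 0) := by
  funext S
  rw [Fintype.sum_bool]
  by_cases hU : S ∈ 𝒰 <;> by_cases hV : S ∈ 𝒱 <;> simp [mix, hU, hV]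

/-- **`R2Hull n ⇒` the typed pair criterion (R2) pointwise**: `0 ≤ r2Slack 𝒰 𝒱 w` on `[0,1]` for union-closed pairs containing `univ`. [this work] -/
theorem r2Slack_nonneg_of_R2Hull {n : ℕ} (h : R2Hull n) (𝒰 𝒱 : Finset (Finset (Fin (n + 1))))
    (hUC : ∀ A ∈ 𝒰, ∀ B ∈ 𝒰, A ∪ B ∈ 𝒰) (hVC : ∀ A ∈ 𝒱, ∀ B ∈ 𝒱, A ∪ B ∈ 𝒱) (hU : univ ∈ 𝒰) (hV : univ ∈ 𝒱)
    {w : ℝ} (hw0 : 0 ≤ w) (hw1 : w ≤ 1) : 0 ≤ GoodDebt.r2Slack 𝒰 𝒱 w := by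
  rw [r2Slack_eq_radialDeriv 𝒰 𝒱 hU hV, mix_eq_mixS_bool]
  refine h Bool (fun b => cond b w (1 - w)) (fun b => cond b 𝒰 𝒱) ?_ ?_ ?_ ?_
  · rintro (_ | _)
    · exact sub_nonneg.2 hw1
    · exact hw0
  · rw [Fintype.sum_bool]; simp
  · rintro (_ | _)
    · exact hVC
    · exact hUC
  · rintro (_ | _)
    · exact hV
    · exact hU

/-! ### STATUS (same session, later): (R2) and (R2-hull) are REFUTED by the CROSSING-STAR pair

The first census of pairs of union-closed families invariant under a Young subgroup WITH DISTINGUISHED POINTS (P4-GEN29-REPORT §3; kit j252123, shape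
`(6,1,1)`, then two independent exact engines) found: for `T = H ⊔ {x,y}`, `|H| = 6`, `𝒰 = {S : x ∈ S, y ∉ S} ∪ {H, T}`, `𝒱 = {S : y ∈ S, x ∉ S} ∪ {H, T}`
(both union-closed, both contain `T`) the degree-8 Bernstein layer vector of `GoodDebt.r2Slack 𝒰 𝒱` is `(5040, 22572, 34632, 16020, −2160, 16020, 34632, 22572, 5040)`:
**`GoodDebt.R2 7` is FALSE**.  Along the family (`|H| = k−2`) the negative layers spread (`k = 9: {4,5}`, …, `k = 18: {6,…,12}`) and from `k = 13` the slack is negative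
POINTWISE at `w = ½` (`−9.6·10⁶`), so **`R2Hull 12` is FALSE**: Sahi's functional is not radially non-decreasing from the top vertex on the union-closed polytope of 13 points.
Conjecture (B) (`P_T ≥_B 0`), the (GD) slack and the `|B|(k−|B|)`-weighted block sum are `≥_B 0` on the whole family (`k ≤ 16`); every (side, root) of gen 26's
`SideCrit` passes (`k ≤ 10`).  Mechanism (coupling form of (R2), report §2): the six co-points `T ∖ z`, `z ∈ H`, are CROSSING (debt in blocks of size 1) and the singletons of
`H` are bad for both labels (fixed-point penalty).  The reductions of this file and of `…RadialDerivative` remain theorems; the hypothesis they reduce to is dead in general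
(it holds on the partial-unions class, above).  A kernel `¬ GoodDebt.R2 7` needs the layer-4 cycle-marked counts of the witness (all-bad configurations = permutations of
`Fin 8` that are neither an 8-cycle nor have a cycle equal to `H`, cycle-minimum label forced to `V` on cycles `∋ x ∌ y`, to `U` on cycles `∋ y ∌ x`, free otherwise) — not done
here; the witness families are recorded below for that purpose. -/

/-- The crossing-star family of `x = 0` against `y = 1` on `Fin (m+3)`: all sets containing `0` and avoiding `1`, plus `H = univ ∖ {0,1}` and `univ`.  With its mirror
image `crossStarV` it refutes (R2) at `m = 5` (8 points) and (R2-hull) pointwise at `m = 10` (module STATUS section). [this work] -/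
def crossStarU (m : ℕ) : Finset (Finset (Fin (m + 3))) :=
  (univ.filter fun S : Finset (Fin (m + 3)) => (0 : Fin (m + 3)) ∈ S ∧ (1 : Fin (m + 3)) ∉ S) ∪ {univ \ {0, 1}, univ}

/-- The mirror family: all sets containing `1` and avoiding `0`, plus `univ ∖ {0,1}` and `univ`. [this work] -/
def crossStarV (m : ℕ) : Finset (Finset (Fin (m + 3))) :=
  (univ.filter fun S : Finset (Fin (m + 3)) => (1 : Fin (m + 3)) ∈ S ∧ (0 : Fin (m + 3)) ∉ S) ∪ {univ \ {0, 1}, univ}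

/-- Membership in the crossing-star family. [this work] -/
theorem mem_crossStarU {m : ℕ} {S : Finset (Fin (m + 3))} :
    S ∈ crossStarU m ↔ ((0 : Fin (m + 3)) ∈ S ∧ (1 : Fin (m + 3)) ∉ S) ∨ S = univ \ {0, 1} ∨ S = univ := by
  unfold crossStarU
  simp only [mem_union, mem_filter, mem_univ, true_and, mem_insert, mem_singleton]

/-- The crossing-star family contains the top. [this work] -/
theorem univ_mem_crossStarU (m : ℕ) : (univ : Finset (Fin (m + 3))) ∈ crossStarU m :=
  mem_crossStarU.2 (Or.inr (Or.inr rfl))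

/-- The crossing-star family is union-closed. [this work] -/
theorem crossStarU_unionClosed (m : ℕ) : ∀ A ∈ crossStarU m, ∀ B ∈ crossStarU m, A ∪ B ∈ crossStarU m := by
  have hH0 : (0 : Fin (m + 3)) ∉ (univ : Finset (Fin (m + 3))) \ {0, 1} := by simp
  have hH1 : (1 : Fin (m + 3)) ∉ (univ : Finset (Fin (m + 3))) \ {0, 1} := by simp
  -- a set containing `0` and avoiding `1`, united with `H`, is `univ ∖ {1}`, which contains `0` and avoids `1`
  have key : ∀ A : Finset (Fin (m + 3)), (0 : Fin (m + 3)) ∈ A → (1 : Fin (m + 3)) ∉ A →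
      (0 : Fin (m + 3)) ∈ A ∪ (univ \ {0, 1}) ∧ (1 : Fin (m + 3)) ∉ A ∪ (univ \ {0, 1}) := fun A h0 h1 =>
    ⟨mem_union_left _ h0, fun h => (mem_union.1 h).elim h1 hH1⟩
  intro A hA B hB
  rw [mem_crossStarU] at hA hB ⊢
  rcases hA with ⟨hA0, hA1⟩ | rfl | rfl
  · rcases hB with ⟨hB0, hB1⟩ | rfl | rfl
    · exact Or.inl ⟨mem_union_left _ hA0, fun h => (mem_union.1 h).elim hA1 hB1⟩
    · exact Or.inl (key A hA0 hA1)
    · exact Or.inr (Or.inr (union_eq_right.2 (subset_univ _)))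
  · rcases hB with ⟨hB0, hB1⟩ | rfl | rfl
    · rw [union_comm]; exact Or.inl (key B hB0 hB1)
    · exact Or.inr (Or.inl (union_idempotent _))
    · exact Or.inr (Or.inr (union_eq_right.2 (subset_univ _)))
  · exact Or.inr (Or.inr (union_eq_left.2 (subset_univ _)))

end RadialDeriv

end Summit.CriticalPhenomena.PercolationContinuityZ3.Theorems
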